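import Summits.BirchSwinnertonDyer.BirchSwinnertonDyer.Theorems.PrintCf2RubinValueTwoEllipticUnitsGlobalMeasureFourDivisible
import Summits.BirchSwinnertonDyer.BirchSwinnertonDyer.Theorems.PrintCf2RubinValueTwoEllipticUnitsTwoVariableMeasureDischargedSteps
import Literature.NumberTheory.NumberFields.RayClassFieldSplitPrimePowerDegreeQuadratic
import HarnessLib

/-!
# de Shalit II.4.12 (p. 69) / II.4.14 at `p = 2`: ANY measure on the DIAGONAL tower with the elliptic-unit twisting relations of the
# two-variable measure of record is DIVISIBLE BY `4`; the normalised measure `Θ(ε_ϑ)·μ/12` has bound `≤ 1`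

Cell `bsd-print-cf2`, width seat `bsd-line-cf2-p1-w8` g12 (piece TW(b) of the named gap G4 «the twelfth root at `p = 2`»); `--supports` crux
stmt-BirchSwinnertonDyer-20368 (SEAM stub `stub_katzSeamSupply_two`, closed modulo `hseam` by `…KatzMeasureJZeroTop.supply_of_chainSeam`).
THEOREMS ONLY; CONDITIONAL on the published named facts de Shalit II.2.4 (ii)/(iii), II.2.5 (i), II.2.7 (hypotheses, never asserted).

THE POINT.  The seam hypothesis `hseam` of `supply_of_chainSeam` hands the seam prover a bounded distribution `μ` on `Γ_K` along the DIAGONAL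
tower `V_n = Gal(K̄/K(𝔣_n v^{n+1}))` of a one-prime-step chain `𝔣_{k+1} = 𝔣_k 𝔩_k`, `𝔣_k = 𝔪_k v̄^{b_k+1}`, together with the twisting relations
`δ_{g_𝔠, N𝔠} μ = i_n(e_{𝔣_n}(𝔠))` at level `n` for every `𝔠` prime to `𝔣_0 v` (VERBATIM the conclusion of
`…TwoVariableMeasureDischargedSteps.exists_twoVariableMeasure_of_principal_split_steps_of_localDatum`), and asks for `μ′` with `μ′.bound ≤ 1`
satisfying the NORMALISED class-sum identity — which holds for `μ′ := Θ(ε_ϑ)·μ/12` (`…KatzMeasureJZeroSeamIdentity.twist_mul_eq_of_perUnit_normalised`,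
input `hI : 12·I′ = Θ(ε_ϑ)·∫χ dμ`), PROVIDED `‖μ/12‖ ≤ 1`, i.e. `μ` is divisible by `4` (`3 ∈ ℤ₂ˣ`).  De Shalit (II.4.12, p. 69): "replace `μ_𝔞`
by `μ_𝔞/12` and repeat the arguments above".  THIS file repeats them on the diagonal:

* §1 (`eq_or_eq_of_two_mem`, private), `isCoprime_span_singleton_span_two`, `isCoprime_span_six_mul` — at a split `2 = v v̄` of a quadratic field the
  primes above `2` are `v, v̄`; coprimality of a twist with `6 𝔣 v`;
* §2 ★★★ `norm_μ_le_norm_four_of_twoVariable_steps` — **`‖μ_n(b)‖ ≤ ‖(4 : ℂ_[2])‖ = ¼` for every `n, b`**, for ANY `μ` on the diagonal tower with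
  the twisting relations (μ.bound unused).  Proof at level `n`: the diagonal level `n` IS level `n` of the one-variable tower at modulus `𝔣_n`;
  choose two principal division twists `(α₁), (α₂)` at modulus `𝔣_n` PRIME TO `6` (G1′ `exists_divisionTwists_twoVariable_general` at
  `𝔪 := (3)·𝔪_n`, so `αᵢ ≡ 1 mod 3𝔣_n`); the one-variable measure of record `μ_n` at `𝔣_n`
  (`EllipticUnitsGlobal.exists_groupDistribution_twisting_eq_induceFrom_ellipticUnitsGlobal_of_principal`) is divisible by `4`
  (`EllipticUnitsGlobal.norm_μ_le_norm_four_of_principal`, GIVEN II.2.7 via TW(a)); and `μ_n(·) = μ_n-of-record(·)` at level `n` by the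
  LEVELWISE uniqueness of division by `δ_{g_{𝔞₁}, N𝔞₁}` (`GroupDistribution.eq_of_twistingFun_eq`), both sides being `i_n(e_{𝔣_n}(𝔞₁))_n`;
* §3 ★★ `exists_bound_le_one_smul_of_twoVariable_steps` — for every `c : ℂ_[2]` with `‖c‖ ≤ 4` there is `μ′` on the same diagonal tower with
  `μ′.bound ≤ 1`, `μ′_n(b) = c·μ_n(b)`, `∫ f dμ′ = c·∫ f dμ` (tower-continuous `f`); ★★ `exists_bound_le_one_twelfth_of_twoVariable_steps` — the
  case `c = Θε/12` (`‖Θε‖ ≤ 1`): `12·μ′_n(b) = Θε·μ_n(b)` and `12·∫ f dμ′ = Θε·∫ f dμ` — EXACTLY the inputs `μ′.bound ≤ 1` of `hseam` and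
  `hI` of `twist_mul_eq_of_perUnit_normalised`.

What is NOT here: the seam identity, the choice `Θε = Θ(ε_ϑ)`, the translate by `τ` (Q-θ).  HONEST FRAMING: an assembly of accepted kernel
theorems over published named facts; nothing here closes a crux; no summit statement is proved; BSD is not proved by any of this.

## References
* [deShalit1987] E. de Shalit, *Iwasawa theory of elliptic curves with complex multiplication* (1987), II.4.12 (p. 66–69, end of proof p. 69),
  II.4.14 Step 1 (p. 71), II.4.16 (p. 76), II.2.7 (p. 49), I.3.1 (p. 15–16).
* [NeukirchANT1999] J. Neukirch, *Algebraic Number Theory* (1999), Ch. I §3 (3.1), §8 (8.2)–(8.3), Ch. VI §7 Thm. (7.1).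
-/

-- the summit namespace `Summit.BirchSwinnertonDyer.BirchSwinnertonDyer` repeats the problem name by design (D-0017)
set_option linter.dupNamespace false
set_option autoImplicit false

noncomputable section

open scoped Classical nonZeroDivisors NumberField
open Field IsDedekindDomain IsDedekindDomain.HeightOneSpectrum ValuativeRel IsLocalRing MvPowerSeries
open Literature.NumberTheory.NumberFields
open Literature.NumberTheory.GaloisRepresentations Literature.NumberTheory.GaloisRepresentations.IsNonarchimedeanLocalField
  Literature.NumberTheory.GaloisRepresentations.LubinTate Literature.NumberTheory.GaloisRepresentations.ArtinLocalGlobal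
  Literature.NumberTheory.PAdicHodge Literature.NumberTheory.LFunctions
open Literature.NumberTheory.EllipticCurves Literature.NumberTheory.EllipticCurves.GroupDistribution
open Literature.NumberTheory.ComplexMultiplication.EllipticUnits
open Literature.NumberTheory.LFunctions.AbelianDensity (artinSymbol)
open Summit.BirchSwinnertonDyer.BirchSwinnertonDyer.Theorems.PrintCf2.EllipticUnitsLocal
open Summit.BirchSwinnertonDyer.BirchSwinnertonDyer.Theorems.PrintCf2.EllipticUnitsGlobal

namespace Summit.BirchSwinnertonDyer.BirchSwinnertonDyer.Theorems.PrintCf2.EllipticUnitsTwoVariable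

variable {K : Type} [Field K] [NumberField K] {v vbar : HeightOneSpectrum (𝓞 K)}

/-! ## §1. The primes above a split `2` of a quadratic field; coprimality of a twist with `6𝔣v` -/

/-- **The primes above `2` are `v` and `v̄`** at a split `2 = v v̄` of a quadratic field: if `2 ∈ w` then `w = v` or `w = v̄`
(`N(v)N(v̄)N(w) ∣ N((2)) = 4` with `N(v) = N(v̄) = 2` forces `N(w) = 1`).  Private norm-count copy of
`FramePinning.eq_or_eq_of_frame_of_two_mem` (`…PrintCf2SplitBadTwoFramePinningTameSet`, via the discriminant), kept private so that the
measure lane does not import the frame-pinning cone. [cite: NeukirchANT1999, Ch. I §8 Prop. (8.2), (8.3)] -/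
private theorem eq_or_eq_of_two_mem (hK2 : Module.finrank ℚ K = 2) (hv2 : ((2 : ℕ) : 𝓞 K) ∈ v.asIdeal)
    (hvbar2 : ((2 : ℕ) : 𝓞 K) ∈ vbar.asIdeal) (hne : vbar ≠ v) (w : HeightOneSpectrum (𝓞 K))
    (hw : ((2 : ℕ) : 𝓞 K) ∈ w.asIdeal) : w = v ∨ w = vbar := by
  by_contra h
  rw [not_or] at h
  have hcop : ∀ {a c : HeightOneSpectrum (𝓞 K)}, a ≠ c → IsCoprime a.asIdeal c.asIdeal := fun {a c} hac ↦
    (Ideal.isCoprime_iff_sup_eq).mpr (Ideal.IsMaximal.coprime_of_ne a.isMaximal c.isMaximal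
      (fun h' ↦ hac (HeightOneSpectrum.ext h')))
  have hvvbar : IsCoprime v.asIdeal vbar.asIdeal := hcop hne.symm
  have hvw : IsCoprime (v.asIdeal * vbar.asIdeal) w.asIdeal := (hcop (Ne.symm h.1)).mul_left (hcop (Ne.symm h.2))
  have hle : Ideal.span {((2 : ℕ) : 𝓞 K)} ≤ v.asIdeal * vbar.asIdeal * w.asIdeal := by
    rw [Ideal.mul_eq_inf_of_isCoprime hvw, Ideal.mul_eq_inf_of_isCoprime hvvbar, le_inf_iff, le_inf_iff,
      Ideal.span_singleton_le_iff_mem, Ideal.span_singleton_le_iff_mem, Ideal.span_singleton_le_iff_mem]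
    exact ⟨⟨hv2, hvbar2⟩, hw⟩
  have hP : Ideal.absNorm (Ideal.span {((2 : ℕ) : 𝓞 K)}) = 2 ^ 2 := by
    rw [IdealNormCount.absNorm_span_natCast K 2, hK2]
  have hdvd : Ideal.absNorm v.asIdeal * Ideal.absNorm vbar.asIdeal * Ideal.absNorm w.asIdeal ∣ 2 ^ 2 := by
    rw [← map_mul, ← map_mul, ← hP]
    exact Ideal.absNorm_dvd_absNorm_of_le hle
  rw [absNorm_eq_of_mem_of_mem_of_ne hK2 Nat.prime_two hv2 hvbar2 hne,
    absNorm_eq_of_mem_of_mem_of_ne hK2 Nat.prime_two hvbar2 hv2 hne.symm] at hdvd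
  have h1 : Ideal.absNorm w.asIdeal ∣ 1 := by
    have h4 : (2 * 2 : ℕ) * Ideal.absNorm w.asIdeal ∣ (2 * 2) * 1 := by simpa [pow_two] using hdvd
    exact Nat.dvd_of_mul_dvd_mul_left (by norm_num) h4
  exact w.isPrime.ne_top (Ideal.absNorm_eq_one_iff.mp (Nat.dvd_one.mp h1))

/-- **A twist outside `v` and `v̄` is prime to `(2)`** (`2 = v v̄` split in a quadratic field). [cite: NeukirchANT1999, Ch. I §8 Prop. (8.3)] -/
theorem isCoprime_span_singleton_span_two (hK2 : Module.finrank ℚ K = 2) (hv2 : ((2 : ℕ) : 𝓞 K) ∈ v.asIdeal)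
    (hvbar2 : ((2 : ℕ) : 𝓞 K) ∈ vbar.asIdeal) (hne : vbar ≠ v) {a : 𝓞 K} (hav : a ∉ v.asIdeal) (havbar : a ∉ vbar.asIdeal) :
    IsCoprime (Ideal.span {a}) (Ideal.span {((2 : ℕ) : 𝓞 K)}) := by
  rw [Ideal.isCoprime_iff_sup_eq]
  by_contra h
  obtain ⟨P, hP, hle⟩ := Ideal.exists_le_maximal _ h
  have h2P : ((2 : ℕ) : 𝓞 K) ∈ P := hle (Ideal.mem_sup_right (Ideal.mem_span_singleton_self _))
  have hP0 : P ≠ ⊥ := by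
    intro hP0
    rw [hP0, Ideal.mem_bot] at h2P
    exact two_ne_zero (by exact_mod_cast h2P)
  have haP : a ∈ P := hle (Ideal.mem_sup_left (Ideal.mem_span_singleton_self a))
  rcases eq_or_eq_of_two_mem hK2 hv2 hvbar2 hne ⟨P, hP.isPrime, hP0⟩ h2P with h' | h'
  · exact hav (by rw [← h']; exact haP)
  · exact havbar (by rw [← h']; exact haP)

/-- **`((a), 6𝔣v) = 1`** from `a ∉ v`, `a ∉ v̄`, `((a), 3) = 1` and `((a), 𝔣v) = 1` (`6 = 2·3`, `2 = v v̄` split in a quadratic field).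
[cite: NeukirchANT1999, Ch. I §3 (3.1), §8 Prop. (8.3)] -/
theorem isCoprime_span_six_mul (hK2 : Module.finrank ℚ K = 2) (hv2 : ((2 : ℕ) : 𝓞 K) ∈ v.asIdeal)
    (hvbar2 : ((2 : ℕ) : 𝓞 K) ∈ vbar.asIdeal) (hne : vbar ≠ v) {a : 𝓞 K} {𝔣 : Ideal (𝓞 K)} (hav : a ∉ v.asIdeal)
    (havbar : a ∉ vbar.asIdeal) (h3 : IsCoprime (Ideal.span {a}) (Ideal.span {(3 : 𝓞 K)}))
    (h𝔣 : IsCoprime (Ideal.span {a}) (𝔣 * v.asIdeal)) :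
    IsCoprime (Ideal.span {a}) (Ideal.span {(6 : 𝓞 K)} * 𝔣 * v.asIdeal) := by
  have h6 : Ideal.span {(6 : 𝓞 K)} = Ideal.span {((2 : ℕ) : 𝓞 K)} * Ideal.span {(3 : 𝓞 K)} := by
    rw [Ideal.span_singleton_mul_span_singleton]
    congr 1
    push_cast
    norm_num
  rw [h6]
  exact (((isCoprime_span_singleton_span_two hK2 hv2 hvbar2 hne hav havbar).mul_right h3).mul_right
    h𝔣.of_mul_right_left).mul_right h𝔣.of_mul_right_right

omit [NumberField K] in
/-- `3 ∉ w` when `2 ∈ w` (`w` a proper ideal: `3 − 2 = 1`). [folklore] -/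
theorem three_not_mem_of_two_mem {w : HeightOneSpectrum (𝓞 K)} (hw : ((2 : ℕ) : 𝓞 K) ∈ w.asIdeal) : (3 : 𝓞 K) ∉ w.asIdeal := by
  intro h3
  refine w.isPrime.ne_top ((Ideal.eq_top_iff_one _).mpr ?_)
  have h : (1 : 𝓞 K) = 3 - ((2 : ℕ) : 𝓞 K) := by push_cast; norm_num
  rw [h]
  exact w.asIdeal.sub_mem h3 hw

/-- `‖3‖ = 1` in `ℂ₂` (`3 = 1 + 2`, `‖2‖₂ < 1`). [folklore] -/
theorem norm_three_padicComplex : ‖(3 : ℂ_[2])‖ = 1 := by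
  have h2 : ‖(2 : ℂ_[2])‖ < 1 := by
    have h4 := norm_four_padicComplex
    rw [show (4 : ℂ_[2]) = 2 * 2 by norm_num, norm_mul] at h4
    nlinarith [norm_nonneg (2 : ℂ_[2]), h4]
  have hle : ‖(3 : ℂ_[2])‖ ≤ 1 := by
    rw [show (3 : ℂ_[2]) = 1 + 2 by norm_num]
    exact (IsUltrametricDist.norm_add_le_max _ _).trans (max_le (by rw [norm_one]) h2.le)
  refine le_antisymm hle ?_
  by_contra hlt
  rw [not_le] at hlt
  have h1 : ‖(1 : ℂ_[2])‖ ≤ max ‖(3 : ℂ_[2])‖ ‖(2 : ℂ_[2])‖ := by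
    rw [show (1 : ℂ_[2]) = 3 + -2 by norm_num, ← norm_neg (2 : ℂ_[2])]
    exact IsUltrametricDist.norm_add_le_max _ _
  rw [norm_one] at h1
  exact absurd h1 (not_le.mpr (max_lt hlt h2))

/-- `‖12‖ = 4⁻¹` in `ℂ₂` (`12 = 4·3`). [folklore] -/
theorem norm_twelve_padicComplex : ‖(12 : ℂ_[2])‖ = (4 : ℝ)⁻¹ := by
  rw [show (12 : ℂ_[2]) = 4 * 3 by norm_num, norm_mul, norm_four_padicComplex, norm_three_padicComplex, mul_one]

/-- ★ **Two principal division twists at the modulus `𝔣 = 𝔪·v̄^{b+1}`, PRIME TO `6`** (G1′ `exists_divisionTwists_twoVariable_general` at the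
modulus `(3)·𝔪`: `αᵢ ≡ 1 mod 3𝔣`, hence `((αᵢ), 3) = 1`; `αᵢ ∉ v̄` because `αᵢ ≡ 1 mod v̄`; `((αᵢ), 2) = 1` by `isCoprime_span_singleton_span_two`):
`α₁, α₂` non-zero, `≡ 1 mod 𝔣`, `((αᵢ), 𝔣v) = 1`, `((αᵢ), 6𝔣v) = 1`, `α₁ − 1 ∈ v^{b+2} ∖ v^{b+3}`, `α₂ − 1 ∈ v^{b+2}`, `α₂ᵏ ≠ α₁ᵏ` in `K_v`
(`k > 0`), `N(α₁) ≥ 2`, `4 ∣ N(α₁) − 1`, `N(α₂) = N(α₁)`.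
[cite: deShalit1987, II.4.12 (p. 66–69), II.4.14 Step 1 (p. 71), II.4.16 (p. 76)] [cite: NeukirchANT1999, Ch. I §3 (3.1), §8 (8.3)] -/
theorem exists_divisionTwists_prime_to_six [NumberField.IsTotallyComplex K] (hK2 : Module.finrank ℚ K = 2)
    (hv2 : ((2 : ℕ) : 𝓞 K) ∈ v.asIdeal) (hvbar2 : ((2 : ℕ) : 𝓞 K) ∈ vbar.asIdeal) (hne : vbar ≠ v)
    {𝔪c 𝔣n : Ideal (𝓞 K)} {bn : ℕ} (h𝔣eq : 𝔣n = 𝔪c * vbar.asIdeal ^ (bn + 1))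
    (h𝔪v : ¬ 𝔪c ≤ v.asIdeal) (h𝔪vbar : ¬ 𝔪c ≤ vbar.asIdeal)
    (hw2 : ∀ u : (𝓞 K)ˣ, (u : 𝓞 K) - 1 ∈ vbar.asIdeal ^ 2 → u = 1) (e₂ : v.adicCompletionIntegers K ≃+* ℤ_[2]) :
    ∃ α₁ α₂ : 𝓞 K, α₁ ≠ 0 ∧ α₂ ≠ 0 ∧ α₁ - 1 ∈ 𝔣n ∧ α₂ - 1 ∈ 𝔣n ∧
      IsCoprime (Ideal.span {α₁}) (𝔣n * v.asIdeal) ∧ IsCoprime (Ideal.span {α₂}) (𝔣n * v.asIdeal) ∧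
      IsCoprime (Ideal.span {α₁}) (Ideal.span {(6 : 𝓞 K)} * 𝔣n * v.asIdeal) ∧
      IsCoprime (Ideal.span {α₂}) (Ideal.span {(6 : 𝓞 K)} * 𝔣n * v.asIdeal) ∧
      α₁ - 1 ∈ v.asIdeal ^ ((bn + 1) + 1) ∧ α₁ - 1 ∉ v.asIdeal ^ ((bn + 1) + 2) ∧ α₂ - 1 ∈ v.asIdeal ^ ((bn + 1) + 1) ∧
      (∀ k : ℕ, 0 < k → ((α₂ : K) : v.adicCompletion K) ^ k ≠ ((α₁ : K) : v.adicCompletion K) ^ k) ∧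
      2 ≤ Ideal.absNorm (Ideal.span {α₁}) ∧ 4 ∣ Ideal.absNorm (Ideal.span {α₁}) - 1 ∧
      Ideal.absNorm (Ideal.span {α₂}) = Ideal.absNorm (Ideal.span {α₁}) := by
  obtain ⟨σ, hσσ, hσv', hnorm⟩ :=
    EllipticUnitsLocal.Discharged.exists_conj_divisionData (K := K) hK2 Nat.prime_two hv2 hvbar2 hne
  have hσv : ∀ y ∈ v.asIdeal, σ y ∈ vbar.asIdeal := conj_mem_of_mem σ hσσ hσv'
  have h𝔪'v : ¬ Ideal.span {(3 : 𝓞 K)} * 𝔪c ≤ v.asIdeal := fun h ↦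
    (v.isPrime.mul_le.mp h).elim
      (fun h3 ↦ three_not_mem_of_two_mem hv2 (h3 (Ideal.mem_span_singleton_self _))) h𝔪v
  have h𝔪'vbar : ¬ Ideal.span {(3 : 𝓞 K)} * 𝔪c ≤ vbar.asIdeal := fun h ↦
    (vbar.isPrime.mul_le.mp h).elim
      (fun h3 ↦ three_not_mem_of_two_mem hvbar2 (h3 (Ideal.mem_span_singleton_self _))) h𝔪vbar
  obtain ⟨α₁, α₂, hα₁0, hα₂0, hα₁𝔪, hα₂𝔪, hα₁c, hα₂c, hs₁, hs₁', hs₂, hne12, hN1, h4, hN12⟩ :=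
    exists_divisionTwists_twoVariable_general h𝔪'v h𝔪'vbar (units_eq_one_mul_sq hw2) e₂ σ hσσ hne hσv' hσv hnorm bn
  have h𝔣' : Ideal.span {(3 : 𝓞 K)} * 𝔪c * vbar.asIdeal ^ (bn + 1) = Ideal.span {(3 : 𝓞 K)} * 𝔣n := by
    rw [h𝔣eq, mul_assoc]
  rw [h𝔣'] at hα₁𝔪 hα₂𝔪 hα₁c hα₂c
  rw [mul_assoc] at hα₁c hα₂c
  have hα₁𝔣 : α₁ - 1 ∈ 𝔣n := Ideal.mul_le_left hα₁𝔪
  have hα₂𝔣 : α₂ - 1 ∈ 𝔣n := Ideal.mul_le_left hα₂𝔪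
  have hα₁c' : IsCoprime (Ideal.span {α₁}) (𝔣n * v.asIdeal) := hα₁c.of_mul_right_right
  have hα₂c' : IsCoprime (Ideal.span {α₂}) (𝔣n * v.asIdeal) := hα₂c.of_mul_right_right
  have h𝔣vbar : 𝔣n ≤ vbar.asIdeal := by
    rw [h𝔣eq]; exact Ideal.mul_le_left.trans (Ideal.pow_le_self (Nat.succ_ne_zero _))
  have hαvbar : ∀ {a : 𝓞 K}, a - 1 ∈ 𝔣n → a ∉ vbar.asIdeal := by
    intro a ha hav
    refine vbar.isPrime.ne_top ((Ideal.eq_top_iff_one _).mpr ?_)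
    have h1 : (1 : 𝓞 K) = a - (a - 1) := by ring
    rw [h1]
    exact vbar.asIdeal.sub_mem hav (h𝔣vbar ha)
  exact ⟨α₁, α₂, hα₁0, hα₂0, hα₁𝔣, hα₂𝔣, hα₁c', hα₂c',
    isCoprime_span_six_mul hK2 hv2 hvbar2 hne (not_mem_of_isCoprime_mul hα₁c' rfl) (hαvbar hα₁𝔣) hα₁c.of_mul_right_left hα₁c',
    isCoprime_span_six_mul hK2 hv2 hvbar2 hne (not_mem_of_isCoprime_mul hα₂c' rfl) (hαvbar hα₂𝔣) hα₂c.of_mul_right_left hα₂c',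
    hs₁, hs₁', hs₂, hne12, hN1, h4, hN12⟩

/-! ## §2. Four-divisibility of any measure on the diagonal tower with the twisting relations -/

section Diagonal

attribute [local instance] ltNormUniformSpace ltNormIsUniformAddGroup rk1 nF nE fintypeResidueField
attribute [local instance] RelNormCoherentUnits.instCommMonoid GlobalNormCoherentUnits.instCommMonoid GlobalNormCoherentUnits.galAction

variable [NumberField.IsTotallyComplex K]
  (h24ii : DeShalit1987.prop24_ii_galoisAction) (h24iii : DeShalit1987.prop24_iii_unit) (h25 : DeShalit1987.prop25_i_normRelation)
  (h27 : DeShalit1987.prop27_power)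
  (hK : IsImaginaryQuadratic K) (ι : K →+* ℂ)
  -- the chain of moduli
  (𝔣 : ℕ → Ideal (𝓞 K)) (𝔩 : ℕ → HeightOneSpectrum (𝓞 K)) (h𝔣succ : ∀ k, 𝔣 (k + 1) = 𝔣 k * (𝔩 k).asIdeal)
  (hdiv : ∀ k, (𝔩 k).asIdeal ∣ 𝔣 k)
  (𝔪c : ℕ → Ideal (𝓞 K)) (b : ℕ → ℕ) (h𝔣eq : ∀ k, 𝔣 k = 𝔪c k * vbar.asIdeal ^ (b k + 1))
  (h𝔪v : ∀ k, ¬ 𝔪c k ≤ v.asIdeal) (h𝔪vbar : ∀ k, ¬ 𝔪c k ≤ vbar.asIdeal)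
  (hw2 : ∀ u : (𝓞 K)ˣ, (u : 𝓞 K) - 1 ∈ vbar.asIdeal ^ 2 → u = 1)
  (hv2 : ((2 : ℕ) : 𝓞 K) ∈ v.asIdeal) (hvbar2 : ((2 : ℕ) : 𝓞 K) ∈ vbar.asIdeal) (hne : vbar ≠ v)
  -- the local model at `v`
  (hq : residueFieldCard (v.adicCompletion K) = 2)
  (h2 : (valuation (v.adicCompletion K)).IsUniformizer ((((2 : ℕ) : 𝒪[v.adicCompletion K]) : v.adicCompletion K)))
  (u : 𝒪[v.adicCompletion K]ˣ)
  {σ₀ : absoluteGaloisGroup (v.adicCompletion K)} (hσ₀ : IsAbsArithFrob σ₀)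
  {ε : (maxUnramifiedCompletion (v.adicCompletion K))ˣ}
  (hε : maxUnramifiedCompletion.galAut (v.adicCompletion K) σ₀ (ε : maxUnramifiedCompletion (v.adicCompletion K)) =
    algebraMap 𝒪[v.adicCompletion K] (maxUnramifiedCompletion (v.adicCompletion K)) (u : 𝒪[v.adicCompletion K]) *
      (ε : maxUnramifiedCompletion (v.adicCompletion K)))
  (θ : CompletedAlgClosure (v.adicCompletion K) →+* ℂ_[2])
  (hθ1 : ∀ z : CBall (v.adicCompletion K), ‖θ (z : CompletedAlgClosure (v.adicCompletion K))‖ ≤ 1)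
  (e₂ : v.adicCompletionIntegers K ≃+* ℤ_[2])
  (hΘe : ∀ a : 𝒪[v.adicCompletion K], (θ.comp ((CBall (v.adicCompletion K)).subtype.comp
      (algebraMap (UnrCoeff (v.adicCompletion K)) (CBall (v.adicCompletion K))))) (intToUnrCoeff (v.adicCompletion K) a) =
    padicIntCast ℂ_[2] (((e₂ : v.adicCompletionIntegers K →+* ℤ_[2]).comp (integerEquivAdicCompletionIntegers v).toRingHom) a))
  -- the per-modulus data (the `∃`-outputs of D2, as `∀`-binders, VERBATIM)
  (h𝔣0 : ∀ m : ℕ, 𝔣 m ≠ ⊥) (h𝔣1 : ∀ m : ℕ, 𝔣 m ≠ ⊤) (hvm : ∀ m : ℕ, ¬ 𝔣 m ≤ v.asIdeal)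
  (hwm : ∀ (m : ℕ) (u : (𝓞 K)ˣ), (u : 𝓞 K) - 1 ∈ 𝔣 m → u = 1) (hle : ∀ m : ℕ, 𝔣 (m + 1) ≤ 𝔣 m)
  (α : ℕ → 𝓞 K) (hα0 : ∀ m, α m ≠ 0) (hα𝔣 : ∀ m, α m - 1 ∈ 𝔣 m)
  (hαw : ∀ (m : ℕ) (w : HeightOneSpectrum (𝓞 K)), w ≠ v → α m ∉ w.asIdeal)
  (f : ℕ → ℕ) (hαπ : ∀ m, ((α m : K) : v.adicCompletion K) =
    ((((u : 𝒪[v.adicCompletion K]) * ((2 : ℕ) : 𝒪[v.adicCompletion K]) : 𝒪[v.adicCompletion K]) : v.adicCompletion K)) ^ f m)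
  (E : ℕ → IntermediateField (v.adicCompletion K) (AlgebraicClosure (v.adicCompletion K)))
  (hfd : ∀ m, FiniteDimensional (v.adicCompletion K) (E m)) (hgal : ∀ m, IsGalois (v.adicCompletion K) (E m))
  (hE : ∀ m, E m ≤ maxUnramified (v.adicCompletion K))
  (hdegE : ∀ (m : ℕ) (w : WeilGroup (v.adicCompletion K)),
    WeilGroup.toAbsGalois (v.adicCompletion K) w ∈ (E m).fixingSubgroup → (f m : ℤ) ∣ WeilGroup.deg w)
  (j : ∀ m : ℕ, unitBall (E m) →+* UnrCoeff (v.adicCompletion K))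
  (hj : ∀ m, (j m).comp (algebraMap (LTCoeff (v.adicCompletion K)) (unitBall (E m))) =
    (intToUnrCoeff (v.adicCompletion K)).comp (LTCoeff.of (v.adicCompletion K)).symm.toRingHom)
  (hjC : ∀ m, (algebraMap (UnrCoeff (v.adicCompletion K)) (CBall (v.adicCompletion K))).comp (j m) = unitBallToCBall (E m))
  (ψ : ∀ m n : ℕ, ↥(absRestrictNormalHom (rayClassField K (𝔣 m))).ker ⧸
    (rayAdicTower (𝔪 := 𝔣 m) (h𝔣0 m) v).U n → ZMod (2 ^ (n + 1)))
  (hψ : ∀ (m n : ℕ) (g : ↥(absRestrictNormalHom (rayClassField K (𝔣 m))).ker),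
    g ∈ (rayAdicTower (𝔪 := 𝔣 m) (h𝔣0 m) v).U 0 →
    ψ m n ((rayAdicTower (𝔪 := 𝔣 m) (h𝔣0 m) v).proj n g) =
      PadicInt.toZModPow (n + 1) ((((Units.map (e₂ : v.adicCompletionIntegers K →+* ℤ_[2]).toMonoidHom).comp
        (rayAdicCharacter (h𝔣0 m) (hvm m) (hwm m)))⁻¹ g : ℤ_[2]ˣ) : ℤ_[2]))
  (g : {c : Ideal (𝓞 K) // c ≠ ⊥ ∧ IsCoprime c (𝔣 0 * v.asIdeal)} → absoluteGaloisGroup K)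
  (hg : ∀ (c : {c : Ideal (𝓞 K) // c ≠ ⊥ ∧ IsCoprime c (𝔣 0 * v.asIdeal)}) (m k : ℕ),
    absRestrictNormalHom (rayClassField K (𝔣 m * v.asIdeal ^ (k + 1))) (g c) =
      artinSymbol (galFrob K (rayClassField K (𝔣 m * v.asIdeal ^ (k + 1)))) c.1)
  (x : ∀ (_ : {c : Ideal (𝓞 K) // c ≠ ⊥ ∧ IsCoprime c (𝔣 0 * v.asIdeal)}) (m k : ℕ),
    rayClassField K (𝔣 m * v.asIdeal ^ (k + 1)))
  (hx : ∀ (c : {c : Ideal (𝓞 K) // c ≠ ⊥ ∧ IsCoprime c (𝔣 0 * v.asIdeal)}) (m k : ℕ),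
    IsThetaValueOne ι (𝔣 m * v.asIdeal ^ (k + 1)) c.1
      (algClosureEmb ι ((x c m k : rayClassField K (𝔣 m * v.asIdeal ^ (k + 1))) : AlgebraicClosure K)))
  (hN : ∀ m n, ((rayAdicTower (𝔪 := 𝔣 m) (h𝔣0 m) v).U n).Normal)
  (hNabs : ∀ m n, ((absRayAdicTower (𝔪' := 𝔣 m) (h𝔣0 m) v).U n).Normal)
  -- ANY measure on the diagonal tower with the twisting relations
  (μ : GroupDistribution (SubgroupTower.diagonal (fun m ↦ absRayAdicTower (𝔪' := 𝔣 m) (h𝔣0 m) v)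
    (fun m n ↦ absRayAdicTower_U_anti (h𝔣0 m) (h𝔣0 (m + 1)) v (hle m) n)) ℂ_[2])
  (hμ : ∀ (c : {c : Ideal (𝓞 K) // c ≠ ⊥ ∧ IsCoprime c (𝔣 0 * v.asIdeal)}) (n : ℕ)
    (b : absoluteGaloisGroup K ⧸ (absRayAdicTower (𝔪' := 𝔣 n) (h𝔣0 n) v).U n),
    (twisting (g c) (Ideal.absNorm c.1 : ℂ_[2]) μ).μ n b =
    (GroupDistribution.induceFrom (Γ := absoluteGaloisGroup K)
      (fun k ↦ rayAdicTower_U_eq_subgroupOf (𝔪 := 𝔣 n) (h𝔣0 n) v k)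
      (fun b : GlobalNormCoherentUnits (h𝔣0 n) v ↦
        localMeasureFamily (h𝔣0 n) (hvm n) (hwm n) hq h2 u (E n) (hE n) hσ₀ hε θ hθ1 (j n) (hjC n) e₂ (ψ n) (hψ n)
          (RelNormCoherentUnits.ofGlobalUnits (h𝔣0 n) (hvm n) (hwm n) (isUniformizer_unit_mul h2 u) (hα0 n) (hα𝔣 n) (hαw n)
            (hαπ n) (E n) (hE n) (hdegE n) b))
      zero_le_one (fun _ ↦ le_rfl)
      (ellipticUnitsGlobal h24iii h25 hK ι (h𝔣0 n) (h𝔣1 n) (hvm n) (hwm n) c.2.1 (isCoprime_chain 𝔣 𝔩 h𝔣succ hdiv c.2.2 n)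
        (x c n) (hx c n))).μ n b)

set_option maxHeartbeats 1600000 in
include h24ii h27 𝔪c b h𝔣eq h𝔪v h𝔪vbar hw2 hv2 hvbar2 hne hΘe hfd hgal hj hg hμ in
/-- ★★★ **ANY measure on the diagonal tower with the elliptic-unit twisting relations is DIVISIBLE BY `4`** (de Shalit II.4.12, p. 69:
"replace `μ_𝔞` by `μ_𝔞/12` and repeat the arguments above" — the `2`-part, on the two-variable tower of II.4.14 Step 1 / II.4.16).  In the
frame of `…TwoVariableMeasureDischargedSteps.exists_twoVariableMeasure_of_principal_split_steps_of_localDatum` (its `∃`-outputs as `∀`-binders,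
VERBATIM; `K` imaginary quadratic, `2 = v·v̄` split, one-prime-step chain `𝔣_k = 𝔪_k v̄^{b_k+1}`), GIVEN II.2.4 (ii)/(iii), II.2.5 (i), II.2.7:
every bounded distribution `μ` along `V_n = Gal(K̄/K(𝔣_n v^{n+1}))` with `δ_{g_𝔠, N𝔠} μ = i_n(e_{𝔣_n}(𝔠))` at level `n` for every `𝔠` prime to
`𝔣_0 v` satisfies **`‖μ_n(b)‖ ≤ ‖(4 : ℂ_[2])‖`** for all `n, b` (`μ.bound` is not used).
[cite: deShalit1987, II.4.12 (p. 66–69), II.4.14 Step 1 (p. 71), II.4.16 (p. 76), II.2.7 (p. 49)] [cite: NeukirchANT1999, Ch. VI §7 Thm. (7.1)] -/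
theorem norm_μ_le_norm_four_of_twoVariable_steps (n : ℕ) (y : absoluteGaloisGroup K ⧸ (absRayAdicTower (𝔪' := 𝔣 n) (h𝔣0 n) v).U n) :
    ‖μ.μ n y‖ ≤ ‖(4 : ℂ_[2])‖ := by
  have hK2 : Module.finrank ℚ K = 2 := hK.1
  -- (1) two principal division twists at modulus `𝔣 n`, PRIME TO `6`
  obtain ⟨α₁, α₂, hα₁0, hα₂0, hα₁𝔣, hα₂𝔣, hα₁c, hα₂c, h6₁, h6₂, hs₁, hs₁', hs₂, hne12, hN1, h4, hN12⟩ :=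
    exists_divisionTwists_prime_to_six hK2 hv2 hvbar2 hne (h𝔣eq n) (h𝔪v n) (h𝔪vbar n) hw2 e₂
  -- back to the index family (`𝔣_n v` and `𝔣_0 v` have the same support)
  have hback : ∀ (m : ℕ) {𝔞 : Ideal (𝓞 K)}, IsCoprime 𝔞 (𝔣 m * v.asIdeal) → IsCoprime 𝔞 (𝔣 0 * v.asIdeal) := by
    intro m 𝔞 h
    induction m with
    | zero => exact h
    | succ m ih => exact ih (h.of_isCoprime_of_dvd_right (mul_dvd_mul (Ideal.dvd_iff_le.mpr (hle m)) dvd_rfl))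
  obtain ⟨a₁, ha₁⟩ : ∃ a : {c : Ideal (𝓞 K) // c ≠ ⊥ ∧ IsCoprime c (𝔣 0 * v.asIdeal)}, a.1 = Ideal.span {α₁} :=
    ⟨⟨Ideal.span {α₁}, mt Ideal.span_singleton_eq_bot.mp hα₁0, hback n hα₁c⟩, rfl⟩
  obtain ⟨a₂, ha₂⟩ : ∃ a : {c : Ideal (𝓞 K) // c ≠ ⊥ ∧ IsCoprime c (𝔣 0 * v.asIdeal)}, a.1 = Ideal.span {α₂} :=
    ⟨⟨Ideal.span {α₂}, mt Ideal.span_singleton_eq_bot.mp hα₂0, hback n hα₂c⟩, rfl⟩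
  rw [← ha₁] at hN1 h4 h6₁
  rw [← ha₁, ← ha₂] at hN12
  rw [← ha₂] at h6₂
  have hs : 1 ≤ b n + 1 := by omega
  -- (2) the one-variable measure of record at modulus `𝔣 n`
  obtain ⟨μn, -, hμn⟩ := exists_groupDistribution_twisting_eq_induceFrom_ellipticUnitsGlobal_of_principal h24ii h24iii h25 hK ι
    (h𝔣0 n) (h𝔣1 n) (hvm n) (hwm n) hq h2 u (hα0 n) (hα𝔣 n) (hαw n) (hαπ n) (E n) (hE n) (hdegE n) hσ₀ hε θ hθ1 (j n) (hj n)
    (hjC n) e₂ hΘe (ψ n) (hψ n) (fun c : {c : Ideal (𝓞 K) // c ≠ ⊥ ∧ IsCoprime c (𝔣 0 * v.asIdeal)} ↦ c.1) (fun c ↦ c.2.1)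
    (fun c ↦ isCoprime_chain 𝔣 𝔩 h𝔣succ hdiv c.2.2 n) g (fun c k ↦ hg c n k) (fun c k ↦ x c n k) (fun c k ↦ hx c n k)
    hs a₁ a₂ ha₁ ha₂ hα₁𝔣 hα₂𝔣 hs₁ hs₁' hs₂ hne12 hN1 h4 hN12
  -- (3) it is divisible by `4`
  have hμn4 : ∀ (k : ℕ) (b' : absoluteGaloisGroup K ⧸ (absRayAdicTower (𝔪' := 𝔣 n) (h𝔣0 n) v).U k), ‖μn.μ k b'‖ ≤ ‖(4 : ℂ_[2])‖ :=
    norm_μ_le_norm_four_of_principal h24iii h25 hK ι (h𝔣0 n) (h𝔣1 n) (hvm n) (hwm n) hq h2 u (hα0 n) (hα𝔣 n) (hαw n) (hαπ n)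
      (E n) (hE n) (hdegE n) hσ₀ hε θ hθ1 (j n) (hjC n) e₂ (ψ n) (hψ n)
      (fun c : {c : Ideal (𝓞 K) // c ≠ ⊥ ∧ IsCoprime c (𝔣 0 * v.asIdeal)} ↦ c.1) (fun c ↦ c.2.1)
      (fun c ↦ isCoprime_chain 𝔣 𝔩 h𝔣succ hdiv c.2.2 n) g (fun c k ↦ hg c n k) (fun c k ↦ x c n k) (fun c k ↦ hx c n k)
      h27 hv2 hvbar2 hne hs a₁ a₂ ha₁ ha₂ hα₁𝔣 hα₂𝔣 hs₁ hs₁' hs₂ hne12 hN1 h4 hN12 h6₁ h6₂ μn (hμn a₁) (hμn a₂)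
  -- (4) at level `n` the given measure IS the measure of record (levelwise uniqueness of the division by `δ_{g_{𝔞₁}, N𝔞₁}`)
  have hkey : μ.μ n y = μn.μ n y :=
    GroupDistribution.diagonal_μ_eq_of_twisting_μ_eq (fun m ↦ absRayAdicTower (𝔪' := 𝔣 m) (h𝔣0 m) v)
      (fun m n ↦ absRayAdicTower_U_anti (h𝔣0 m) (h𝔣0 (m + 1)) v (hle m) n) μ n μn (g a₁)
      (fun k hk ↦ TwistingDiv.natCast_pow_ne_one hN1 hk) _ (hμ a₁ n) (hμn a₁ n) y
  rw [hkey]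
  exact hμn4 n y

include h24ii h27 𝔪c b h𝔣eq h𝔪v h𝔪vbar hw2 hv2 hvbar2 hne hΘe hfd hgal hj hg hμ in
/-- ★★ **The NORMALISED two-variable measure**: in the setting of `norm_μ_le_norm_four_of_twoVariable_steps`, for every `c : ℂ_[2]` with
`‖c‖ ≤ 4` there is a bounded distribution `μ′` on the same diagonal tower with `μ′.bound ≤ 1`, `μ′_n(b) = c·μ_n(b)` and `∫ f dμ′ = c·∫ f dμ` for
tower-continuous `f`. [cite: deShalit1987, II.4.12 (p. 69), II.4.14 Step 1 (p. 71), I.3.1 (p. 15–16)] -/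
theorem exists_bound_le_one_smul_of_twoVariable_steps (c : ℂ_[2]) (hc : ‖c‖ ≤ 4) :
    ∃ μ' : GroupDistribution (SubgroupTower.diagonal (fun m ↦ absRayAdicTower (𝔪' := 𝔣 m) (h𝔣0 m) v)
        (fun m n ↦ absRayAdicTower_U_anti (h𝔣0 m) (h𝔣0 (m + 1)) v (hle m) n)) ℂ_[2],
      μ'.bound ≤ 1 ∧
      (∀ (n : ℕ) (b : absoluteGaloisGroup K ⧸ (absRayAdicTower (𝔪' := 𝔣 n) (h𝔣0 n) v).U n), μ'.μ n b = c * μ.μ n b) ∧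
      ∀ f : absoluteGaloisGroup K → ℂ_[2],
        (SubgroupTower.diagonal (fun m ↦ absRayAdicTower (𝔪' := 𝔣 m) (h𝔣0 m) v)
          (fun m n ↦ absRayAdicTower_U_anti (h𝔣0 m) (h𝔣0 (m + 1)) v (hle m) n)).IsTowerContinuous f →
        μ'.integral f = c * μ.integral f := by
  obtain ⟨μ', hb', hμ', hint⟩ := GroupDistribution.exists_smul_of_norm_μ_le μ
    (norm_μ_le_norm_four_of_twoVariable_steps h24ii h24iii h25 h27 hK ι 𝔣 𝔩 h𝔣succ hdiv 𝔪c b h𝔣eq h𝔪v h𝔪vbar hw2 hv2 hvbar2 hne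
      hq h2 u hσ₀ hε θ hθ1 e₂ hΘe h𝔣0 h𝔣1 hvm hwm hle α hα0 hα𝔣 hαw f hαπ E hfd hgal hE hdegE j hj hjC ψ hψ g hg x hx hN hNabs μ hμ) c
  refine ⟨μ', ?_, hμ', hint⟩
  rw [hb', norm_four_padicComplex]
  calc ‖c‖ * (4 : ℝ)⁻¹ ≤ 4 * (4 : ℝ)⁻¹ := by gcongr
    _ = 1 := by norm_num

include h24ii h27 𝔪c b h𝔣eq h𝔪v h𝔪vbar hw2 hv2 hvbar2 hne hΘe hfd hgal hj hg hμ in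
/-- ★★ **The measure `Θε·μ/12` is integral** (de Shalit II.4.12, p. 69: "`μ(𝔣) = μ/12` is also integral" — at `p = 2`, GIVEN II.2.7): in the
setting of `norm_μ_le_norm_four_of_twoVariable_steps`, for every `Θε : ℂ_[2]` with `‖Θε‖ ≤ 1` there is a bounded distribution `μ′` on the same
diagonal tower with **`μ′.bound ≤ 1`**, `12·μ′_n(b) = Θε·μ_n(b)` and **`12·∫ f dμ′ = Θε·∫ f dμ`** for tower-continuous `f` — the inputs
`μ′.bound ≤ 1` of `hseam` and `hI` of `…KatzMeasureJZeroSeamIdentity.twist_mul_eq_of_perUnit_normalised` (`I′ := ∫ ê dμ′`).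
[cite: deShalit1987, II.4.12 (p. 69), II.4.14 (36)–(40) (p. 71–73), I.3.1 (p. 15–16)] -/
theorem exists_bound_le_one_twelfth_of_twoVariable_steps (Θε : ℂ_[2]) (hΘε : ‖Θε‖ ≤ 1) :
    ∃ μ' : GroupDistribution (SubgroupTower.diagonal (fun m ↦ absRayAdicTower (𝔪' := 𝔣 m) (h𝔣0 m) v)
        (fun m n ↦ absRayAdicTower_U_anti (h𝔣0 m) (h𝔣0 (m + 1)) v (hle m) n)) ℂ_[2],
      μ'.bound ≤ 1 ∧
      (∀ (n : ℕ) (b : absoluteGaloisGroup K ⧸ (absRayAdicTower (𝔪' := 𝔣 n) (h𝔣0 n) v).U n),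
        (12 : ℂ_[2]) * μ'.μ n b = Θε * μ.μ n b) ∧
      ∀ f : absoluteGaloisGroup K → ℂ_[2],
        (SubgroupTower.diagonal (fun m ↦ absRayAdicTower (𝔪' := 𝔣 m) (h𝔣0 m) v)
          (fun m n ↦ absRayAdicTower_U_anti (h𝔣0 m) (h𝔣0 (m + 1)) v (hle m) n)).IsTowerContinuous f →
        (12 : ℂ_[2]) * μ'.integral f = Θε * μ.integral f := by
  have h12 : (12 : ℂ_[2]) ≠ 0 := by norm_num
  have hc : ‖Θε / 12‖ ≤ 4 := by
    rw [norm_div, norm_twelve_padicComplex, div_inv_eq_mul]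
    linarith
  obtain ⟨μ', hb', hμ', hint⟩ := exists_bound_le_one_smul_of_twoVariable_steps h24ii h24iii h25 h27 hK ι 𝔣 𝔩 h𝔣succ hdiv 𝔪c b
    h𝔣eq h𝔪v h𝔪vbar hw2 hv2 hvbar2 hne hq h2 u hσ₀ hε θ hθ1 e₂ hΘe h𝔣0 h𝔣1 hvm hwm hle α hα0 hα𝔣 hαw f hαπ E hfd hgal hE hdegE j hj hjC
    ψ hψ g hg x hx hN hNabs μ hμ (Θε / 12) hc
  refine ⟨μ', hb', fun n b ↦ ?_, fun f hf ↦ ?_⟩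
  · rw [hμ' n b, ← mul_assoc, mul_div_cancel₀ _ h12]
  · rw [hint f hf, ← mul_assoc, mul_div_cancel₀ _ h12]

end Diagonal

end Summit.BirchSwinnertonDyer.BirchSwinnertonDyer.Theorems.PrintCf2.EllipticUnitsTwoVariable

end
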